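import Summits.CriticalPhenomena.PercolationContinuityZ3.Theorems.Transplant.DependentPercolationQuadrant
import Literature.Probability.Percolation.SlabCriticalityProofs
import HarnessLib

/-!
# The slab `S_k = ℤ² × {0,…,k}` percolates INSIDE A QUARTER-SLAB `ℤ₊² × {0,…,k}` at every `p` with `θ_{S_k}(p) > 0`

builds on p205010 (kernel theorem, internal audit signed; external expert review pending) — NOT used in this file.
Lane `prim-bschramm`, seat `prim-bschramm-p2` (gen 21; class C1b, METHOD = input substitution; memo `HOME/bschramm/P2-LATTICES.md` §64);
helper file (`--supports stmt-CriticalPhenomena-4575 --as helper`).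

THE POINT.  For `ℍ ⊂ ℤ^d`, `p_c(ℍ) = p_c(ℤ^d)` is Grimmett–Marstrand (typed for `zdGraph d` only); the C1b table listed the half-slab
`ℤ × ℤ₊ × {0,…,k} ⊂ S_k` at its own critical point under the "GM wall".  For slabs of `ℤ³` no GM theorem is needed: DST's finite-size criterion
(`DuminilCopinSidoraviciusTassion2016_goodEvent_likely_holds`) holds AT every `p` with `θ_{S_k}(p) > 0`, the good coarse edges form a `5`-dependent
bond percolation of density `> 1 - η`, by `DepQuadrant.dependentPercolation_quadrant` they percolate INSIDE THE COARSE QUADRANT, and the gluing of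
DST §2.2 (`slabConn_of_glue` run with the region `T_n = {z₁, z₂ ≥ -6n}`) yields an infinite open path of the slab inside `T_n × {0,…,k}`, a translate of
the quarter-slab: **`exists_percolatesVia_pos_of_theta_slab_pos`** — `θ_{S_k}(0, p) > 0 ⇒ P_p(a ↔ ∞ inside T_n × {0,…,k}) > 0` for some block
size `n` and some `a ∈ \overline{B_n}` (every `k ≥ 1`, every `p`).
* §1 `slabConn_of_coarse_reachable_in`, `exists_percolatesVia_of_coarse` (DST §2.2 with the region bookkeeping); §2 `exists_percolatesVia_pos_of_theta_slab_pos`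
  (image measure of `P_p` under the good-edge map, verbatim from `DuminilCopinSidoraviciusTassion2016_renormalisation_of_dependentPercolation`);
  the quarter-slab geometry and the vertex-level transfer `theta_quarterSlab_pos_of_theta_slab_pos` are in `Transplant/QuarterSlabOwnCriticalPoint.lean`.
[cite: DuminilCopinSidoraviciusTassion2016, §2.1 eq. (13), §2.2 (p. 6)] [cite: GrimmettPercolation1999, §7.2 Thm. (7.2) p. 148, §1.6 p. 16]
-/

noncomputable section

namespace Summit.CriticalPhenomena.PercolationContinuityZ3.Theorems.Transplant

namespace QuarterSlab

open MeasureTheory Literature.Probability.Percolation Literature.Probability.LatticeModels SimpleGraph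
open scoped ENNReal

variable (k : ℕ)

/-! ## §1 From an infinite good cluster in the coarse quadrant to an infinite open path inside `T × {0,…,k}` -/

/-! Throughout, the planar region `T_n = {z | -6n ≤ z₁, -6n ≤ z₂}` (a translate of the quarter-plane containing every fine box used by
the coarse edges of the quadrant `ℤ₊²` at block size `n`) is written out as a set; `Transplant/QuarterSlabOwnCriticalPoint.lean` names it. -/

/-- The box `R_n = 4n·x + 2n eᵢ + B_{6n}` of a coarse edge `{x, x + eᵢ}` with `x ∈ ℤ₊²` lies in `T_n`. [folklore] -/
theorem sqBox_six_subset_region {n : ℕ} {x : Site 2} (hx0 : 0 ≤ x 0) (hx1 : 0 ≤ x 1) (i : Fin 2) :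
    sqBox (coarsePt n x + coarseShift (2 * n) i) (6 * n) ⊆ {z : ℤ × ℤ | -(6 * (n : ℤ)) ≤ z.1 ∧ -(6 * (n : ℤ)) ≤ z.2} := by
  intro w hw
  simp only [sqBox, Set.mem_setOf_eq, abs_le, coarsePt, coarseShift, Prod.fst_add, Prod.snd_add] at hw
  simp only [Set.mem_setOf_eq]
  have h0 : (0 : ℤ) ≤ 4 * (n : ℤ) * x 0 := by positivity
  have h1 : (0 : ℤ) ≤ 4 * (n : ℤ) * x 1 := by positivity
  fin_cases i <;> simp at hw ⊢ <;> omega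

/-- The uniqueness box `4n·x + B_{3n}` of a coarse vertex `x ∈ ℤ₊²` lies in `T_n`. [folklore] -/
theorem sqBox_three_subset_region {n : ℕ} {x : Site 2} (hx0 : 0 ≤ x 0) (hx1 : 0 ≤ x 1) :
    sqBox (coarsePt n x) (3 * n) ⊆ {z : ℤ × ℤ | -(6 * (n : ℤ)) ≤ z.1 ∧ -(6 * (n : ℤ)) ≤ z.2} :=
  (sqBox_subset_region_left n (coarsePt n x) 0).trans (sqBox_six_subset_region hx0 hx1 0)

/-- The origin block `B_u`, `u ≤ n`, lies in `T_n`. [folklore] -/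
theorem sqBox_zero_subset_region {n u : ℕ} (hu : u ≤ n) : sqBox 0 u ⊆ {z : ℤ × ℤ | -(6 * (n : ℤ)) ≤ z.1 ∧ -(6 * (n : ℤ)) ≤ z.2} := by
  intro w hw
  simp only [sqBox, Set.mem_setOf_eq, abs_le, Prod.fst_zero, Prod.snd_zero, sub_zero] at hw
  simp only [Set.mem_setOf_eq]
  omega

/-- An edge of the step graph of the quadrant has both endpoints in the quadrant. [folklore] -/
theorem mem_quad_of_mem_edgeSet {b c : Site 2}
    (h : s(b, c) ∈ (withinGraph (zdGraph 2) ({x : Site 2 | 0 ≤ x 0 ∧ 0 ≤ x 1} : Set (Site 2))).edgeSet) :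
    (0 ≤ b 0 ∧ 0 ≤ b 1) ∧ (0 ≤ c 0 ∧ 0 ≤ c 1) := by
  rw [SimpleGraph.mem_edgeSet, withinGraph_adj] at h
  exact ⟨h.2.1, h.2.2⟩

/-- **Chaining good edges inside the region** (DST 2016, §2.2 with the region bookkeeping): if the coarse vertex `y ≠ 0` is joined to `0` by
good edges OF THE QUADRANT `ℤ₊²`, then `\overline{B_u}` is joined to `\overline{4n·y + B_u}` by an open path of the slab all of whose vertices
lie in `\overline{T_n}` (lattice configurations; the mechanism is `slabConn_of_glue`). [cite: DuminilCopinSidoraviciusTassion2016, §2.2] -/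
theorem slabConn_of_coarse_reachable_in {ω : BondConfig (slab 3 k)}
    (hω : ω ⊆ (slabGraph 3 k).edgeSet) {n u : ℕ} (hu : u ≤ n) {y : Site 2}
    (hy : (openGraph (coarseConfig k n u ω ∩
      (withinGraph (zdGraph 2) ({x : Site 2 | 0 ≤ x 0 ∧ 0 ≤ x 1} : Set (Site 2))).edgeSet)).Reachable 0 y) (hy0 : y ≠ 0) :
    ω ∈ slabConn k {z : ℤ × ℤ | -(6 * (n : ℤ)) ≤ z.1 ∧ -(6 * (n : ℤ)) ≤ z.2} (sqBox 0 u) (sqBox (coarsePt n y) u) := by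
  rw [SimpleGraph.reachable_iff_reflTransGen] at hy
  suffices h : y = 0 ∨ ω ∈ slabConn k {z : ℤ × ℤ | -(6 * (n : ℤ)) ≤ z.1 ∧ -(6 * (n : ℤ)) ≤ z.2} (sqBox 0 u) (sqBox (coarsePt n y) u) by tauto
  clear hy0
  induction hy with
  | refl => exact Or.inl rfl
  | @tail b c _ hbc ih =>
    right
    obtain ⟨⟨hmem, hquad⟩, -⟩ := (openGraph_adj _ b c).1 hbc
    obtain ⟨⟨hb0, hb1⟩, ⟨hc0, hc1⟩⟩ := mem_quad_of_mem_edgeSet hquad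
    obtain ⟨x, i, he, hcross, huz, huz'⟩ := hmem
    have hmono : ∀ {B X Y : Set (ℤ × ℤ)}, B ⊆ {z : ℤ × ℤ | -(6 * (n : ℤ)) ≤ z.1 ∧ -(6 * (n : ℤ)) ≤ z.2} → ω ∈ slabConn k B X Y → ω ∈ slabConn k {z : ℤ × ℤ | -(6 * (n : ℤ)) ≤ z.1 ∧ -(6 * (n : ℤ)) ≤ z.2} X Y :=
      fun hB h => openCrossing_mono (slabLift_mono k hB) subset_rfl subset_rfl h
    rw [Sym2.eq_iff] at he
    by_cases hb00 : b = 0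
    · -- the first edge of the chain
      subst hb00
      rcases he with ⟨hx, hc⟩ | ⟨hx, hc⟩
      · subst hc
        subst hx
        rw [coarsePt_add_single]
        simpa using hmono (sqBox_six_subset_region hb0 hb1 i) hcross
      · subst hc
        have h0 : coarsePt n c + coarseShift (4 * n) i = 0 := by
          rw [← coarsePt_add_single, ← hx, coarsePt_zero]
        rw [h0] at hcross
        rw [slabConn_comm]
        exact hmono (sqBox_six_subset_region hc0 hc1 i) hcross
    · -- gluing through the block at `b`
      have hb : ω ∈ slabConn k {z : ℤ × ℤ | -(6 * (n : ℤ)) ≤ z.1 ∧ -(6 * (n : ℤ)) ≤ z.2} (sqBox 0 u) (sqBox (coarsePt n b) u) := by tauto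
      rcases he with ⟨hx, hc⟩ | ⟨hx, hc⟩
      · -- `b = x`, `c = x + eᵢ`
        subst hc
        subst hx
        rw [coarsePt_add_single]
        refine slabConn_of_glue k hω (T := {z : ℤ × ℤ | -(6 * (n : ℤ)) ≤ z.1 ∧ -(6 * (n : ℤ)) ≤ z.2}) (B₁ := {z : ℤ × ℤ | -(6 * (n : ℤ)) ≤ z.1 ∧ -(6 * (n : ℤ)) ≤ z.2})
          (B₂ := sqBox (coarsePt n b + coarseShift (2 * n) i) (6 * n)) (S' := sqBox (coarsePt n b) u)
          (c := coarsePt n b) (m := 3 * n) subset_rfl (sqBox_six_subset_region hb0 hb1 i)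
          (sqBox_three_subset_region hb0 hb1)
          (sqBox_mono _ (by omega)) (sqBox_zero_inter_subset_sqSphere hu hb00)
          (sqBox_shift_inter_subset_sqSphere hu (coarsePt n b) i).1 hb ?_ huz
        rw [slabConn_comm]
        exact hcross
      · -- `b = x + eᵢ`, `c = x`
        subst hc
        have hcb : coarsePt n b = coarsePt n c + coarseShift (4 * n) i := by
          rw [hx, coarsePt_add_single]
        rw [hcb] at hb
        have hfar : sqBox 0 u ∩ sqBox (coarsePt n c + coarseShift (4 * n) i) (3 * n) ⊆
            sqSphere (coarsePt n c + coarseShift (4 * n) i) (3 * n) := by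
          rw [← hcb]; exact sqBox_zero_inter_subset_sqSphere hu hb00
        have h3 : sqBox (coarsePt n c + coarseShift (4 * n) i) (3 * n) ⊆ {z : ℤ × ℤ | -(6 * (n : ℤ)) ≤ z.1 ∧ -(6 * (n : ℤ)) ≤ z.2} := by
          rw [← hcb]; exact sqBox_three_subset_region hb0 hb1
        exact slabConn_of_glue k hω (T := {z : ℤ × ℤ | -(6 * (n : ℤ)) ≤ z.1 ∧ -(6 * (n : ℤ)) ≤ z.2}) (B₁ := {z : ℤ × ℤ | -(6 * (n : ℤ)) ≤ z.1 ∧ -(6 * (n : ℤ)) ≤ z.2})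
          (B₂ := sqBox (coarsePt n c + coarseShift (2 * n) i) (6 * n))
          (S' := sqBox (coarsePt n c + coarseShift (4 * n) i) u)
          (c := coarsePt n c + coarseShift (4 * n) i) (m := 3 * n) subset_rfl (sqBox_six_subset_region hc0 hc1 i)
          h3 (sqBox_mono _ (by omega)) hfar
          (sqBox_shift_inter_subset_sqSphere hu (coarsePt n c) i).2 hb hcross huz'

/-- An open path inside `\overline{T}` puts its endpoint into the `T̄`-constrained cluster. [folklore] -/
theorem mem_openClusterIn_of_openConnIn {ω : BondConfig (slab 3 k)} (hω : ω ⊆ (slabGraph 3 k).edgeSet)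
    {T : Set (ℤ × ℤ)} {a b : slab 3 k} (h : ω ∈ openConnIn (slabLift k T) a b) :
    b ∈ openClusterIn (withinGraph (slabGraph 3 k) (slabLift k T)) ω a := by
  have ha : a ∈ slabLift k T := h.1
  rw [openClusterIn_withinGraph_eq_top (slabGraph 3 k) (slabLift k T) hω]
  change ω ∈ openConnVia (withinGraph ⊤ (slabLift k T)) a b
  rwa [← openConnIn_eq_openConnVia ha]

/-- **An infinite good cluster of the origin IN THE COARSE QUADRANT forces an infinite open cluster INSIDE `\overline{T_n}` at a vertex of
`\overline{B_u}`** (DST 2016, §2.2, "an infinite path of good edges … implies the existence of an infinite path of open edges in the original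
lattice", with the region bookkeeping; lattice configurations `ω`). [cite: DuminilCopinSidoraviciusTassion2016, §2.2] -/
theorem exists_percolatesVia_of_coarse {ω : BondConfig (slab 3 k)}
    (hω : ω ⊆ (slabGraph 3 k).edgeSet) {n u : ℕ} (hn : 1 ≤ n) (hu : u ≤ n)
    (hinf : (openCluster (coarseConfig k n u ω ∩
      (withinGraph (zdGraph 2) ({x : Site 2 | 0 ≤ x 0 ∧ 0 ≤ x 1} : Set (Site 2))).edgeSet) (0 : Site 2)).Infinite) :
    ∃ a ∈ slabLift k (sqBox 0 u), ω ∈ percolatesVia (withinGraph (slabGraph 3 k) (slabLift k {z : ℤ × ℤ | -(6 * (n : ℤ)) ≤ z.1 ∧ -(6 * (n : ℤ)) ≤ z.2})) a := by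
  by_contra hcon
  push Not at hcon
  set KT := withinGraph (slabGraph 3 k) (slabLift k {z : ℤ × ℤ | -(6 * (n : ℤ)) ≤ z.1 ∧ -(6 * (n : ℤ)) ≤ z.2}) with hKT
  have hX0fin : (slabLift k (sqBox 0 u)).Finite := slabLift_finite k (sqBox_finite 0 u)
  have hU : (⋃ a ∈ slabLift k (sqBox 0 u), openClusterIn KT ω a).Finite :=
    hX0fin.biUnion fun a ha => Set.not_infinite.1 (hcon a ha)
  -- a bound on the planar coordinates of the finitely many constrained clusters
  obtain ⟨M, hM⟩ : ∃ M : ℕ, ∀ v ∈ ⋃ a ∈ slabLift k (sqBox 0 u), openClusterIn KT ω a,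
      |(planar k v).1| ≤ M ∧ |(planar k v).2| ≤ M := by
    have himg := hU.image fun v => max |(planar k v).1| |(planar k v).2|
    obtain ⟨B, hB⟩ := himg.bddAbove
    refine ⟨B.toNat, fun v hv => ?_⟩
    have h := hB (Set.mem_image_of_mem _ hv)
    have h' : max |(planar k v).1| |(planar k v).2| ≤ (B.toNat : ℤ) := h.trans (Int.self_le_toNat B)
    exact ⟨(le_max_left _ _).trans h', (le_max_right _ _).trans h'⟩
  -- a far coarse vertex in the good quadrant cluster of `0`
  obtain ⟨y, hy, hyF⟩ := hinf.exists_notMem_finset (box 2 (M + u))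
  have hy0 : y ≠ 0 := by
    rintro rfl
    apply hyF
    rw [mem_box]
    intro i
    simp only [Pi.zero_apply]
    push_cast
    omega
  obtain ⟨a, ha, b, hb, hab⟩ := slabConn_of_coarse_reachable_in k hω hu hy hy0
  have hbU : b ∈ ⋃ a ∈ slabLift k (sqBox 0 u), openClusterIn KT ω a :=
    Set.mem_biUnion ha (mem_openClusterIn_of_openConnIn k hω hab)
  obtain ⟨hb1, hb2⟩ := hM b hbU
  -- but `planar b ∈ 4n·y + B_u` is far
  have hyfar : (M : ℤ) + u + 1 ≤ |y 0| ∨ (M : ℤ) + u + 1 ≤ |y 1| := by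
    simp only [mem_box, not_forall] at hyF
    obtain ⟨j, hj⟩ := hyF
    fin_cases j
    · left; rw [le_abs]; simp at hj; omega
    · right; rw [le_abs]; simp at hj; omega
  have hcp := abs_le_abs_coarsePt hn y
  simp only [mem_slabLift_iff, sqBox, Set.mem_setOf_eq] at hb
  rw [abs_le] at hb1 hb2
  obtain ⟨hb3, hb4⟩ := hb
  rw [abs_le] at hb3 hb4
  rcases hyfar with h | h
  · have h1 : (M : ℤ) + u + 1 ≤ |(coarsePt n y).1| := h.trans hcp.1
    rw [le_abs] at h1
    omega
  · have h1 : (M : ℤ) + u + 1 ≤ |(coarsePt n y).2| := h.trans hcp.2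
    rw [le_abs] at h1
    omega

/-! ## §2 The measure-level transfer: `θ_{S_k}(p) > 0` gives percolation inside `\overline{T_n}` with positive probability -/

/-- **Supercritical slabs percolate inside a translate of the quarter-slab** (`k > 0`): if `θ_{S_k}(0, p) > 0` then for some block size `n ≥ 1`
and some vertex `a` of `\overline{B_n}`, `P_p(a ↔ ∞ inside \overline{T_n}) > 0`.  DST's finite-size criterion at `p`
(`DuminilCopinSidoraviciusTassion2016_goodEvent_likely_holds`), the good-edge law as a `5`-dependent bond percolation on `ℤ²`
(`disjoint_coarseRegion`, `real_goodEvent_shift`), dependent percolation in the quadrant (`DepQuadrant.dependentPercolation_quadrant`) and §1.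
[cite: DuminilCopinSidoraviciusTassion2016, §2.1 eq. (13) and §2.2 (p. 6)] -/
theorem exists_percolatesVia_pos_of_theta_slab_pos (hk : 0 < k) (p : unitInterval)
    (hθ : 0 < theta (slabGraph 3 k) (slabOrigin 3 k) p) :
    ∃ n : ℕ, 1 ≤ n ∧ ∃ a ∈ slabLift k (sqBox 0 n),
      0 < (bondPercolation (slabGraph 3 k) p).real (percolatesVia (withinGraph (slabGraph 3 k) (slabLift k {z : ℤ × ℤ | -(6 * (n : ℤ)) ≤ z.1 ∧ -(6 * (n : ℤ)) ≤ z.2})) a) := by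
  obtain ⟨-, -, hD5⟩ := DepQuadrant.dependentPercolation_quadrant 5
  set η₀ : ℝ := (1 / 256 : ℝ) ^ (4 * (2 * (5 + 1) ^ 2)) with hη₀
  have hη₀pos : 0 < η₀ := by rw [hη₀]; positivity
  clear_value η₀
  obtain ⟨n, u, hn, hu, hgood⟩ := DuminilCopinSidoraviciusTassion2016_goodEvent_likely_holds k hk p hθ η₀ hη₀pos
  set P := bondPercolation (slabGraph 3 k) p with hP
  set Kq := withinGraph (zdGraph 2) ({x : Site 2 | 0 ≤ x 0 ∧ 0 ≤ x 1} : Set (Site 2)) with hKq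
  -- the good-edge configuration as a dependent bond percolation on `ℤ²`
  set μ := P.map (coarseConfig k n u) with hμ
  haveI : IsProbabilityMeasure μ :=
    Measure.isProbabilityMeasure_map (measurable_coarseConfig k n u).aemeasurable
  have hdep : ∀ (F₁ F₂ : Finset (Sym2 (Site 2))),
      (∀ e₁ ∈ F₁, ∀ e₂ ∈ F₂, ∀ a ∈ e₁, ∀ b ∈ e₂, ((5 : ℕ) : ℤ) ≤ max |a 0 - b 0| |a 1 - b 1|) →
      ∀ (A B : Set (BondConfig (Site 2))), DeterminedBy A (↑F₁ : Set (Sym2 (Site 2))) →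
        DeterminedBy B (↑F₂ : Set (Sym2 (Site 2))) → MeasurableSet A → MeasurableSet B →
        μ (A ∩ B) = μ A * μ B := by
    intro F₁ F₂ hfar A B hA hB hAm hBm
    rw [hμ, Measure.map_apply (measurable_coarseConfig k n u) (hAm.inter hBm),
      Measure.map_apply (measurable_coarseConfig k n u) hAm,
      Measure.map_apply (measurable_coarseConfig k n u) hBm, Set.preimage_inter]
    exact bondPercolation_inter_of_disjoint (slabGraph 3 k) p
      (disjoint_coarseRegion k hn (by exact_mod_cast hfar))
      (determinedBy_preimage_coarseConfig k n u hA) (determinedBy_preimage_coarseConfig k n u hB)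
      (hAm.preimage (measurable_coarseConfig k n u)) (hBm.preimage (measurable_coarseConfig k n u))
  have hmarg : ∀ e ∈ (zdGraph 2).edgeSet, 1 - η₀ ≤ μ.real {ω | e ∈ ω} := by
    intro e he
    have key : ∀ (x : Site 2) (i : Fin 2),
        1 - η₀ ≤ μ.real {ω : BondConfig (Site 2) | s(x, x + Pi.single i 1) ∈ ω} := by
      intro x i
      rw [hμ, map_measureReal_apply (measurable_coarseConfig k n u) (measurableSet_mem _)]
      have hpre : coarseConfig k n u ⁻¹' {ω : BondConfig (Site 2) | s(x, x + Pi.single i 1) ∈ ω} =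
          goodEvent k n u (coarsePt n x) i := by
        ext ω; exact mk_mem_coarseConfig_iff k n u ω x i
      rw [hpre, hP, real_goodEvent_shift]
      have h1 := hgood i
      linarith
    induction e using Sym2.ind with
    | h a b =>
      rw [SimpleGraph.mem_edgeSet] at he
      obtain ⟨i, hab | hab⟩ := (zdGraph_adj_iff a b).1 he
      · rw [hab]; exact key a i
      · rw [hab, Sym2.eq_swap]; exact key b i
  -- percolation of the good edges inside the coarse quadrant, transferred to the slab
  have hperc := hD5 μ hdep hmarg
  rw [hμ, map_measureReal_apply (measurable_coarseConfig k n u) (measurableSet_percolatesVia Kq 0)] at hperc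
  have hle : P.real (coarseConfig k n u ⁻¹' percolatesVia Kq 0) ≤
      P.real (⋃ a ∈ slabLift k (sqBox 0 u), percolatesVia (withinGraph (slabGraph 3 k) (slabLift k {z : ℤ × ℤ | -(6 * (n : ℤ)) ≤ z.1 ∧ -(6 * (n : ℤ)) ≤ z.2})) a) := by
    refine ENNReal.toReal_mono (measure_ne_top _ _) (measure_mono_ae ?_)
    filter_upwards [ProbabilityTheory.setBernoulli_ae_subset (u := (slabGraph 3 k).edgeSet) (p := p)] with ω hω hmem
    obtain ⟨a, ha, hinf⟩ := exists_percolatesVia_of_coarse k hω hn hu hmem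
    exact Set.mem_biUnion ha hinf
  obtain ⟨a, ha, hθa⟩ : ∃ a ∈ slabLift k (sqBox 0 u),
      0 < P.real (percolatesVia (withinGraph (slabGraph 3 k) (slabLift k {z : ℤ × ℤ | -(6 * (n : ℤ)) ≤ z.1 ∧ -(6 * (n : ℤ)) ≤ z.2})) a) := by
    by_contra hcon
    push Not at hcon
    have hnull : P (⋃ a ∈ slabLift k (sqBox 0 u),
        percolatesVia (withinGraph (slabGraph 3 k) (slabLift k {z : ℤ × ℤ | -(6 * (n : ℤ)) ≤ z.1 ∧ -(6 * (n : ℤ)) ≤ z.2})) a) = 0 := by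
      refine (measure_biUnion_null_iff (slabLift_finite k (sqBox_finite 0 u)).countable).2 fun a ha => ?_
      have := hcon a ha
      have h0 : P.real (percolatesVia (withinGraph (slabGraph 3 k) (slabLift k {z : ℤ × ℤ | -(6 * (n : ℤ)) ≤ z.1 ∧ -(6 * (n : ℤ)) ≤ z.2})) a) = 0 :=
        le_antisymm this measureReal_nonneg
      exact (measureReal_eq_zero_iff (measure_ne_top _ _)).1 h0
    have : P.real (⋃ a ∈ slabLift k (sqBox 0 u),
        percolatesVia (withinGraph (slabGraph 3 k) (slabLift k {z : ℤ × ℤ | -(6 * (n : ℤ)) ≤ z.1 ∧ -(6 * (n : ℤ)) ≤ z.2})) a) = 0 := by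
      rw [measureReal_def, hnull]; simp
    linarith
  exact ⟨n, hn, a, slabLift_mono k (sqBox_mono 0 hu) ha, hθa⟩

end QuarterSlab

end Summit.CriticalPhenomena.PercolationContinuityZ3.Theorems.Transplant

end
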